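import Summits.Ventures.PercRepro.Night2LocalRuleDQ

/-!
# PercRepro — Theorem E modulo the pair count (night-2, gen 8)

Theorem E of `proofs/NIGHT-2-local.md` §17(k): at a rank-`(q+1)` flat `G` with `d = |E ∖ G| = q` and `k` coloops
of `M|G` with `2k ≤ (q+1−k)²`, the local form (LI_G) holds.  This file assembles the kernel pieces —
the certificate `localShadowHall_of_distance_two`, the loss bound `loss_le_dq` ((k2)), the residual capacity
`cap2_ge_dq` ((k4)) and the concave inequality `ineq_k5` ((k5)) — into **`localShadowHall_dq_of_pairs`**, whose
one remaining hypothesis is (k3), the count of the members carrying layer-2 weight at a shadow set `S`: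
`2 · #{B : w2 B S ≠ 0} ≤ (q+2−κ₀(S)) (q+1−κ₀(S))`, `κ₀(S)` the number of coloops of `S`.  On paper (k3) is the
count of the 2-element cocircuits of `M|S` by the series classes of `M|S`; it is the only piece of Theorem E not
yet in the kernel.

Also: `kColoops` (the coloops of `M|G`), `k1_le_kColoops` (layer-0 preimages are indexed by coloops of `M|G`),
`kColoops_le_card_coloops` (every coloop of `M|G` is a coloop of every spanning set).
-/

namespace PercRepro.Shadow

open Finset PerFlat ThmH

variable {α : Type*} [DecidableEq α] {M : Matroid α} [M.Finite]

open scoped Classical in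
/-- The coloops of `M|G`. -/
noncomputable def kColoops (M : Matroid α) [M.Finite] (G : Finset α) : ℕ :=
  (G.filter (fun y => y ∉ clF M (G.erase y))).card

open scoped Classical in
/-- The coloop members of `S ⊆ G` are coloops of `M|G`. -/
theorem card_coloopMembers_le_kColoops {q : ℕ} {G S : Finset α} (hS : S ⊆ G) :
    (coloopMembers M q G S).card ≤ kColoops M G := by
  unfold kColoops
  apply Finset.card_le_card
  intro y hy
  rw [mem_coloopMembers] at hy
  rw [Finset.mem_filter]
  exact ⟨hS hy.1, hy.2.1⟩

open scoped Classical in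
/-- `k1 S ≤ #coloopMembers S` (the injection of `k1_le`). -/
theorem k1_le_card_coloopMembers {q : ℕ} {G S : Finset α} :
    k1 M q G S ≤ (coloopMembers M q G S).card := by
  unfold k1
  have key : ∀ B ∈ (coverPreimages M (Uq M (q + 2) q) G S).filter (fun B => B ∈ lay0 M q G),
      ∃ y, S = insert y B ∧ y ∈ coloopMembers M q G S ∧ y ∉ B := by
    intro B hB
    rw [Finset.mem_filter, mem_coverPreimages] at hB
    obtain ⟨⟨hBm, hcov⟩, hB0⟩ := hB
    obtain ⟨z, hz, rfl⟩ := mem_coverSets.1 hcov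
    have hBU : B ∈ Uq M (q + 2) q := (mem_membersIn.1 hBm).1
    have hzB : z ∉ B := notMem_of_notMem_clF hBU (Finset.mem_sdiff.1 hz).2
    refine ⟨z, rfl, ?_, hzB⟩
    rw [mem_coloopMembers]
    refine ⟨Finset.mem_insert_self _ _, ?_, by rw [Finset.erase_insert hzB]; exact hBU⟩
    have h1 : (G \ clF M B).card = 1 := (mem_lay0.1 hB0).2.1
    have hBG : clF M B ⊆ G := (mem_membersIn.1 hBm).2
    have hsing : G \ clF M B = {z} := by
      rw [Finset.card_eq_one] at h1
      obtain ⟨a, ha⟩ := h1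
      rw [ha] at hz ⊢
      rw [Finset.mem_singleton] at hz
      rw [hz]
    have hGe : G.erase z = clF M B := by
      ext e
      rw [Finset.mem_erase]
      constructor
      · rintro ⟨hez, heG⟩
        by_contra hecl
        have : e ∈ G \ clF M B := Finset.mem_sdiff.2 ⟨heG, hecl⟩
        rw [hsing, Finset.mem_singleton] at this
        exact hez this
      · intro hecl
        refine ⟨fun h => ?_, hBG hecl⟩
        rw [h] at hecl
        exact (Finset.mem_sdiff.1 hz).2 hecl
    rw [hGe]
    intro hzcl
    have hidem : clF M (clF M B) = clF M B := by
      rw [← Finset.coe_inj, coe_clF, coe_clF, Matroid.closure_closure]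
    rw [hidem] at hzcl
    exact (Finset.mem_sdiff.1 hz).2 hzcl
  have hinj : Set.InjOn (fun B : Finset α => S \ B)
      ((coverPreimages M (Uq M (q + 2) q) G S).filter (fun B => B ∈ lay0 M q G) : Set (Finset α)) := by
    intro B hB B' hB' hBB'
    have h1 : B ⊆ S := by
      obtain ⟨y, hy, -, -⟩ := key B hB
      rw [hy]; exact Finset.subset_insert _ _
    have h2 : B' ⊆ S := by
      obtain ⟨y, hy, -, -⟩ := key B' hB'
      rw [hy]; exact Finset.subset_insert _ _
    have h3 : S \ B = S \ B' := hBB'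
    calc B = S \ (S \ B) := (Finset.sdiff_sdiff_eq_self h1).symm
      _ = S \ (S \ B') := by rw [h3]
      _ = B' := Finset.sdiff_sdiff_eq_self h2
  rw [← Finset.card_image_of_injOn hinj]
  refine le_trans (Finset.card_le_card ?_) (Finset.card_image_le (f := fun y : α => ({y} : Finset α)))
  intro T hT
  rw [Finset.mem_image] at hT ⊢
  obtain ⟨B, hB, rfl⟩ := hT
  obtain ⟨y, hy, hyc, hyB⟩ := key B hB
  refine ⟨y, hyc, ?_⟩
  rw [hy, Finset.insert_sdiff_of_notMem _ hyB, Finset.sdiff_self, Finset.insert_empty]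

open scoped Classical in
/-- `k1 S ≤ kColoops G` for `S ⊆ G`. -/
theorem k1_le_kColoops {q : ℕ} {G S : Finset α} (hS : S ⊆ G) :
    k1 M q G S ≤ kColoops M G :=
  k1_le_card_coloopMembers.trans (card_coloopMembers_le_kColoops hS)

open scoped Classical in
/-- Every coloop of `M|G` lies in every shadow set with closure `G` and is a coloop of it. -/
theorem kColoops_le_card_coloops {q : ℕ} {G S : Finset α}
    (hS : S ∈ shadowAt M (q + 2) q (Uq M (q + 2) q) G) : kColoops M G ≤ (coloops M S).card := by
  unfold kColoops
  have hSG : S ⊆ G := subset_of_mem_shadowAt hS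
  have hcl : clF M S = G := (mem_shadowAt.1 hS).2
  apply Finset.card_le_card
  intro y hy
  rw [Finset.mem_filter] at hy
  have hyS : y ∈ S := by
    by_contra hyS
    have hsub : S ⊆ G.erase y := fun e he => Finset.mem_erase.2 ⟨fun h => hyS (h ▸ he), hSG he⟩
    have := clF_mono (M := M) hsub
    rw [hcl] at this
    exact hy.2 (this hy.1)
  rw [mem_coloops]
  refine ⟨hyS, fun h => hy.2 ?_⟩
  exact clF_mono (Finset.erase_subset_erase y hSG) h

/-- `x/(q+1−x)` is monotone for `x ≤ k ≤ q`. -/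
theorem lossBound_mono {q x k : ℕ} (hxk : x ≤ k) (hk : k ≤ q) :
    (x : ℚ) / ((((q : ℚ) + 1) ^ 2) * (((q : ℚ) + 1) - (x : ℚ))) ≤
      (k : ℚ) / ((((q : ℚ) + 1) ^ 2) * (((q : ℚ) + 1) - (k : ℚ))) := by
  have hx' : (x : ℚ) ≤ (k : ℚ) := by exact_mod_cast hxk
  have hk' : (k : ℚ) ≤ (q : ℚ) := by exact_mod_cast hk
  have h1 : (0 : ℚ) < ((q : ℚ) + 1) - (k : ℚ) := by linarith
  have h2 : (0 : ℚ) < ((q : ℚ) + 1) - (x : ℚ) := by linarith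
  have hq : (0 : ℚ) < ((q : ℚ) + 1) ^ 2 := by positivity
  rw [div_le_div_iff₀ (by positivity) (by positivity)]
  have key : (x : ℚ) * (((q : ℚ) + 1) - (k : ℚ)) ≤ (k : ℚ) * (((q : ℚ) + 1) - (x : ℚ)) := by nlinarith
  have := mul_le_mul_of_nonneg_left key hq.le
  nlinarith [this]

open scoped Classical in
/-- A nonzero layer-2 weight at `S` is at most `2 k/((q+1)²(q+1−k))`, `k = kColoops G`, when `d = q`. -/
theorem w2_le_dq {q : ℕ} {G : Finset α} (hG : G ∈ flatsQ M (q + 1)) (hd : (gr M \ G).card = q)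
    (hk : kColoops M G ≤ q) {B S : Finset α} (hB : B ∈ membersIn M (Uq M (q + 2) q) G) :
    w2 M q G B S ≤ 2 * ((kColoops M G : ℚ) / ((((q : ℚ) + 1) ^ 2) * (((q : ℚ) + 1) - (kColoops M G : ℚ)))) := by
  have hstar : 0 ≤ (kColoops M G : ℚ) / ((((q : ℚ) + 1) ^ 2) * (((q : ℚ) + 1) - (kColoops M G : ℚ))) := by
    have : (kColoops M G : ℚ) ≤ (q : ℚ) := by exact_mod_cast hk
    have h1 : (0 : ℚ) < ((q : ℚ) + 1) - (kColoops M G : ℚ) := by linarith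
    positivity
  unfold w2
  split_ifs with h
  · obtain ⟨hB0, hBS, hsub, hcard⟩ := h
    have hm : 2 ≤ (G \ clF M B).card := hcard ▸ Finset.card_le_card hsub
    have hden : (1 : ℚ) ≤ ((G \ clF M B).card : ℚ) - 1 := by
      have : (2 : ℚ) ≤ ((G \ clF M B).card : ℚ) := by exact_mod_cast hm
      linarith
    -- each loss ≤ ℓ*
    have hloss : ∀ z ∈ S \ B, loss M q G B z ≤
        (kColoops M G : ℚ) / ((((q : ℚ) + 1) ^ 2) * (((q : ℚ) + 1) - (kColoops M G : ℚ))) := by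
      intro z hz
      have hz' : z ∈ G \ clF M B := hsub hz
      refine (loss_le_dq hG hd hB hB0 hz').trans (lossBound_mono ?_ hk)
      have hSG' : insert z B ⊆ G := subset_of_mem_shadowAt (insert_mem_shadowAt (Finset.Subset.refl _) hG hB hz')
      exact k1_le_kColoops hSG'
    have hsum : ∑ z ∈ S \ B, loss M q G B z ≤
        2 * ((kColoops M G : ℚ) / ((((q : ℚ) + 1) ^ 2) * (((q : ℚ) + 1) - (kColoops M G : ℚ)))) := by
      calc ∑ z ∈ S \ B, loss M q G B z
          ≤ ∑ _z ∈ S \ B, (kColoops M G : ℚ) / ((((q : ℚ) + 1) ^ 2) * (((q : ℚ) + 1) - (kColoops M G : ℚ))) :=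
            Finset.sum_le_sum hloss
        _ = 2 * ((kColoops M G : ℚ) / ((((q : ℚ) + 1) ^ 2) * (((q : ℚ) + 1) - (kColoops M G : ℚ)))) := by
            rw [Finset.sum_const, hcard, nsmul_eq_mul]; push_cast; ring
    have hnn : 0 ≤ ∑ z ∈ S \ B, loss M q G B z :=
      Finset.sum_nonneg (fun z hz => loss_nonneg (capS_nonneg' hG hd.le _))
    calc (∑ z ∈ S \ B, loss M q G B z) / (((G \ clF M B).card : ℚ) - 1)
        ≤ (∑ z ∈ S \ B, loss M q G B z) / 1 := by
          apply div_le_div_of_nonneg_left hnn one_pos hden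
      _ = ∑ z ∈ S \ B, loss M q G B z := div_one _
      _ ≤ _ := hsum
  · exact mul_nonneg two_pos.le hstar

open scoped Classical in
/-- The members carrying layer-2 weight at `S`. -/
noncomputable def ex2 (M : Matroid α) [M.Finite] (q : ℕ) (G S : Finset α) : Finset (Finset α) :=
  (membersIn M (Uq M (q + 2) q) G).filter (fun B => w2 M q G B S ≠ 0)

open scoped Classical in
/-- `load2 S ≤ #ex2 S · 2ℓ*` at `d = q`. -/
theorem load2_le_dq {q : ℕ} {G : Finset α} (hG : G ∈ flatsQ M (q + 1)) (hd : (gr M \ G).card = q)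
    (hk : kColoops M G ≤ q) (S : Finset α) :
    load2 M q G S ≤ ((ex2 M q G S).card : ℚ) *
      (2 * ((kColoops M G : ℚ) / ((((q : ℚ) + 1) ^ 2) * (((q : ℚ) + 1) - (kColoops M G : ℚ))))) := by
  unfold load2
  rw [← Finset.sum_filter_ne_zero]
  have : ∀ B ∈ (membersIn M (Uq M (q + 2) q) G).filter (fun B => w2 M q G B S ≠ 0),
      w2 M q G B S ≤ 2 * ((kColoops M G : ℚ) / ((((q : ℚ) + 1) ^ 2) * (((q : ℚ) + 1) - (kColoops M G : ℚ)))) := by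
    intro B hB
    rw [Finset.mem_filter] at hB
    exact w2_le_dq hG hd hk hB.1
  refine (Finset.sum_le_sum this).trans ?_
  rw [Finset.sum_const, nsmul_eq_mul]
  unfold ex2
  exact le_refl _

open scoped Classical in
/-- **THEOREM E modulo the pair count (k3).**  At `d = q` with `k = kColoops G` coloops of `M|G`, `2k ≤ (q+1−k)²`,
and at every shadow set `S` at most `(q+2−κ₀(S))(q+1−κ₀(S))/2` members carrying layer-2 weight (`κ₀(S)` the
number of coloops of `S`), the local form holds at `G`. -/
theorem localShadowHall_dq_of_pairs {q : ℕ} {G : Finset α} (hG : G ∈ flatsQ M (q + 1))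
    (hd : (gr M \ G).card = q) (hk : 2 * kColoops M G ≤ (q + 1 - kColoops M G) ^ 2)
    (hpairs : ∀ S ∈ shadowAt M (q + 2) q (Uq M (q + 2) q) G,
      2 * (ex2 M q G S).card ≤ (q + 2 - (coloops M S).card) * (q + 1 - (coloops M S).card)) :
    LocalShadowHall M q G := by
  have hkq : kColoops M G ≤ q := by
    by_contra hlt
    push Not at hlt
    have : q + 1 - kColoops M G = 0 := by omega
    rw [this] at hk
    simp at hk
    omega
  apply localShadowHall_of_distance_two hG hd.le
  intro S hS
  set k := kColoops M G with hkdef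
  set a := (coloops M S).card with hadef
  have hSG : S ⊆ G := subset_of_mem_shadowAt hS
  have hka : k ≤ a := kColoops_le_card_coloops hS
  have ha : a ≤ q + 1 := by
    have hrk : M.eRk (S : Set α) = ((q + 1 : ℕ) : ℕ∞) := eRk_eq_of_mem_Yq_diag (mem_shadow.1 (mem_shadowAt.1 hS).1).1
    exact card_coloops_le (hSG.trans (mem_flatsQ.1 hG).1) hrk
  have hk1 : (k1 M q G S : ℚ) ≤ (k : ℚ) := by exact_mod_cast k1_le_kColoops hSG
  have hcap := cap2_ge_dq hG hd hS
  have hload := load2_le_dq hG hd hkq S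
  have hq1 : (0 : ℚ) < (q : ℚ) + 1 := by positivity
  have hqk : (0 : ℚ) < ((q : ℚ) + 1) - (k : ℚ) := by
    have : (k : ℚ) ≤ (q : ℚ) := by exact_mod_cast hkq
    linarith
  -- the pair count in ℚ
  have hp := hpairs S hS
  have hp' : 2 * ((ex2 M q G S).card : ℚ) ≤ ((q : ℚ) + 2 - (a : ℚ)) * ((q : ℚ) + 1 - (a : ℚ)) := by
    have h1 : ((q + 2 - a : ℕ) : ℚ) = (q : ℚ) + 2 - (a : ℚ) := by rw [Nat.cast_sub (by omega)]; push_cast; ring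
    have h2 : ((q + 1 - a : ℕ) : ℚ) = (q : ℚ) + 1 - (a : ℚ) := by rw [Nat.cast_sub (by omega)]; push_cast; ring
    have := (Nat.cast_le (α := ℚ)).2 hp
    push_cast at this
    rw [h1, h2] at this
    exact this
  have hstar : 0 ≤ (k : ℚ) / ((((q : ℚ) + 1) ^ 2) * (((q : ℚ) + 1) - (k : ℚ))) := by positivity
  -- load2 ≤ (q+2−a)(q+1−a) k / ((q+1)²(q+1−k))
  have hload' : load2 M q G S ≤
      ((q : ℚ) + 2 - (a : ℚ)) * ((q : ℚ) + 1 - (a : ℚ)) * ((k : ℚ) / ((((q : ℚ) + 1) ^ 2) * (((q : ℚ) + 1) - (k : ℚ)))) := by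
    refine hload.trans ?_
    calc ((ex2 M q G S).card : ℚ) * (2 * ((k : ℚ) / ((((q : ℚ) + 1) ^ 2) * (((q : ℚ) + 1) - (k : ℚ)))))
        = (2 * ((ex2 M q G S).card : ℚ)) * ((k : ℚ) / ((((q : ℚ) + 1) ^ 2) * (((q : ℚ) + 1) - (k : ℚ)))) := by ring
      _ ≤ _ := mul_le_mul_of_nonneg_right hp' hstar
  -- the concave inequality, with the case a = q + 1 separately
  rcases Nat.lt_or_ge a (q + 1) with haq | haq
  · have haq' : a ≤ q := by omega
    have hineq := ineq_k5 hka haq' hk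
    have hden : (0 : ℚ) < (((q : ℚ) + 1) ^ 2) * (((q : ℚ) + 1) - (k : ℚ)) := by positivity
    have hfinal : ((q : ℚ) + 2 - (a : ℚ)) * ((q : ℚ) + 1 - (a : ℚ)) *
        ((k : ℚ) / ((((q : ℚ) + 1) ^ 2) * (((q : ℚ) + 1) - (k : ℚ)))) ≤
        ((((q : ℚ) + 1) * (((q : ℚ) + 1) - (a : ℚ)) - (k : ℚ)) / (((q : ℚ) + 1) ^ 2)) := by
      rw [← mul_div_assoc, div_le_div_iff₀ hden (by positivity)]
      have hq2 : (0 : ℚ) < ((q : ℚ) + 1) ^ 2 := by positivity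
      nlinarith [mul_le_mul_of_nonneg_right hineq hq2.le]
    have hcap' : ((((q : ℚ) + 1) * (((q : ℚ) + 1) - (a : ℚ)) - (k : ℚ)) / (((q : ℚ) + 1) ^ 2)) ≤ cap2 M q G S := by
      refine le_trans ?_ hcap
      apply div_le_div_of_nonneg_right _ (by positivity)
      linarith
    linarith
  · -- a = q + 1: no pairs, load2 = 0
    have haeq : a = q + 1 := le_antisymm ha haq
    have hz : ((q : ℚ) + 1 - (a : ℚ)) = 0 := by rw [haeq]; push_cast; ring
    have hl0 : load2 M q G S ≤ 0 := by
      refine hload'.trans (le_of_eq ?_)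
      rw [hz]; ring
    have hc0 : 0 ≤ cap2 M q G S := cap2_nonneg (capS_nonneg hG hd.le hSG)
    linarith

end PercRepro.Shadow
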